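import Summits.BirchSwinnertonDyer.BirchSwinnertonDyer.Theorems.SchneiderFreeAdditiveX3PoitouTateMuMiddleExact
import Literature.NumberTheory.GaloisRepresentations.KummerUnramifiedUnit
import Literature.NumberTheory.GaloisRepresentations.DecompositionGroupOfCompletion
import Literature.NumberTheory.AdelicBaseChange.AdicCompletionDensity
import HarnessLib

/-!
# Poitou–Tate toolkit (μₚ-case, 3/·): Kummer classes of local units are UNRAMIFIED away from `p`,
# and Milne *ADT* I Thm. 4.10(b) `Ker γ¹ ⊆ Im β¹` for `M = μₚ` over a totally complex number field

Seat `bsd-schneider-door-c6`, gen 6 (cell `bsd-schneider-ideate`; crux `AnticycControlAdditiveK`,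
stmt-BirchSwinnertonDyer-19295).  THEOREMS ONLY.  HONEST FRAMING: proves the `μₚ`-instance (prime
level, `K` totally complex) of the middle exactness of the Poitou–Tate sequence for THE invariant maps —
the FIRST module for which the hypothesis `hE` of `exists_localInvariants_duality_of_middleExact_canonical`
(p484492) is a tree theorem; it does NOT prove `hE` for a general finite module, hence no case of
`poitouTate_selmerStructure_duality` and no case of BSD.

* §1 `smul_root_eq_of_mem_inertia_of_pow_eq` — **inertia fixes the `d`-th roots of a `w`-unit,
  `w ∤ d`** (Neukirch, *Class Field Theory* III (7.7), proof; Silverman AEC VIII.1.6): the tree's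
  `smul_root_eq_of_mem_inertia` WITHOUT the hypothesis `μ_d ⊆ k` (the ratio `σα/α` is a `d`-th root of
  unity `η` in the integral closure; `(η - 1)α ∈ 𝔓`, `α ∉ 𝔓`, so `η ≡ 1 (mod 𝔓)`, and `1 - η` divides
  the order of `η`, which divides `d ∉ w`).
* §2 `localization_δ₀_mem_unramifiedSubgroup_of_not_mem` — for `a ∈ 𝓞_K` with `a ∉ w`, `p ∉ w`, the
  localisation at `w` of the Kummer class `κₚ(a)` lies in `unramifiedSubgroup` (criterion
  `LocBridge.mem_unramifiedSubgroup_one_iff_exists`; `I(K_w)` maps into `I_𝔓₀ ≤ Γ_K`,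
  `inertia_adicCompletionPrime_eq_map_absInertia`);
  `localization_δ₀_mem_unramifiedSubgroup_of_eq_unit_mul_pow` — the same for `a ∈ Kˣ` lying in
  `𝒪_wˣ · (K_wˣ)ᵖ` (density of `𝓞_K` in `𝒪_w`, `closureAlgebraMapIntegers_eq_integers`).
* §3 **`middleExact_mu`** — Milne I Thm. 4.10(b) `Ker γ¹ ⊆ Im β¹` for `M = μₚ`, `K` totally complex:
  `middleExact_mu_of_kummerUnramified` (file 2/·) with its hypothesis `hKU` discharged by §2.

References: [MilneADT2006] I Thm. 4.10(b), I §2; [Neukirch2013] Part III Thm. (7.7) (proof);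
[SilvermanAEC2009] Prop. VIII.1.6; [CasselsFrohlichANT1967] VII §5.1, §11; [SerreLocalFields1979] XIV §1.
-/

noncomputable section

open CategoryTheory Function NumberField IsDedekindDomain Field ValuativeRel IntermediateField
open scoped NumberField Pointwise

set_option linter.dupNamespace false

namespace Summit.BirchSwinnertonDyer.BirchSwinnertonDyer.Theorems.SchneiderFreeAdditiveX3.PoitouTateReduction

open _root_.ContinuousCohomology
open Literature.NumberTheory.GaloisRepresentations
open Literature.NumberTheory.GaloisRepresentations.DiscreteGaloisModule
open Literature.NumberTheory.GaloisRepresentations.IsNonarchimedeanLocalField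
open Literature.NumberTheory.GaloisCohomology
open Literature.NumberTheory.NumberFields
open Literature.AnabelianGeometry.AbsoluteAnabelian
open Literature.AnabelianGeometry.AbsoluteAnabelian.Prop121vii
open Summit.BirchSwinnertonDyer.Rank1Residual.X11b

/-! ## §1. Inertia fixes the `d`-th roots of `w`-units (`w ∤ d`), without `μ_d ⊆ k` -/

section KummerUnit

universe u

variable {k : Type u} [Field k] {Ω : Type u} [Field Ω] [Algebra k Ω]

/-- **Inertia fixes the `d`-th roots of a `w`-unit, `w ∤ d`** — the tree's
`smul_root_eq_of_mem_inertia` without the hypothesis that `k` contains the `d`-th roots of unity.  For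
`a ∈ 𝓞_k`, `a ∉ w`, `d ∉ w`, `α ∈ Ω` with `α^d = a`, a prime `𝔓` of the integral closure of `𝓞_k` in
`Ω` above `w`, and `σ ∈ I_𝔓 ≤ Aut(Ω/k)`: `σ α = α`.  (Neukirch: «`Xⁿ - a = 0` is separable over the
residue field, so that `K_𝔭(ⁿ√a)|K_𝔭` is unramified»; Silverman VIII.1.6.)
[cite: Neukirch2013, Part III Thm. (7.7) (proof, p. 176)] [cite: SilvermanAEC2009, Prop. VIII.1.6 (proof)] -/
theorem smul_root_eq_of_mem_inertia_of_pow_eq {d : ℕ} (hd : 0 < d)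
    {a : 𝓞 k} (w : HeightOneSpectrum (𝓞 k)) (haw : a ∉ w.asIdeal)
    (hdw : ((d : ℕ) : 𝓞 k) ∉ w.asIdeal) {α : Ω} (hα : α ^ d = algebraMap (𝓞 k) Ω a)
    (𝔓 : Ideal (integralClosure (𝓞 k) Ω)) [𝔓.IsPrime] [h𝔓 : 𝔓.LiesOver w.asIdeal]
    {σ : Ω ≃ₐ[k] Ω} (hσ : σ ∈ 𝔓.inertia (Ω ≃ₐ[k] Ω)) : σ α = α := by
  classical
  -- `a ≠ 0`, `α ≠ 0`, and `η = σα/α` is a `d`-th root of unity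
  have ha0 : (a : k) ≠ 0 := fun h => haw (by
    rw [(RingOfIntegers.coe_eq_zero_iff).mp h]
    exact w.asIdeal.zero_mem)
  have hα' : α ^ d = algebraMap k Ω (a : k) := by
    rw [hα, IsScalarTower.algebraMap_apply (𝓞 k) k Ω]
  have hα0 : α ≠ 0 := fun h => by
    rw [h, zero_pow hd.ne'] at hα'
    exact ha0 ((map_eq_zero_iff _ (algebraMap k Ω).injective).mp hα'.symm)
  set η : Ω := σ α * α⁻¹ with hηdef
  have hσα : σ α = η * α := by rw [hηdef, inv_mul_cancel_right₀ hα0]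
  have hηd : η ^ d = 1 := by
    have h1 : (σ α) ^ d = α ^ d := by rw [← map_pow, hα', AlgEquiv.commutes]
    rw [hηdef, mul_pow, h1, inv_pow, mul_inv_cancel₀ (pow_ne_zero d hα0)]
  -- `α` and `η` as elements `b`, `e` of the integral closure `B`
  have hαint : IsIntegral (𝓞 k) α := IsIntegral.of_pow hd (by rw [hα]; exact isIntegral_algebraMap)
  have hηint : IsIntegral (𝓞 k) η := IsIntegral.of_pow hd (by rw [hηd]; exact isIntegral_one)
  set b : integralClosure (𝓞 k) Ω := ⟨α, hαint⟩ with hbdef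
  set e : integralClosure (𝓞 k) Ω := ⟨η, hηint⟩ with hedef
  have hbd : b ^ d = algebraMap (𝓞 k) (integralClosure (𝓞 k) Ω) a := Subtype.ext (by
    change α ^ d = algebraMap (𝓞 k) Ω a
    exact hα)
  have hed : e ^ d = 1 := Subtype.ext (by change η ^ d = 1; exact hηd)
  -- `σ • b = e * b` and `σ • b - b ∈ 𝔓`, so `(e - 1) b ∈ 𝔓`
  have hσb : σ • b = e * b := Subtype.ext (by
    change σ α = η * α
    exact hσα)
  have h1 : σ • b - b ∈ 𝔓 := by
    rw [Ideal.inertia, AddSubgroup.mem_inertia] at hσ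
    exact hσ b
  have h2 : (e - 1) * b ∈ 𝔓 := by
    rw [sub_mul, one_mul, ← hσb]
    exact h1
  -- `b ∉ 𝔓` since `b^d = a ∉ w`
  have hover : w.asIdeal = 𝔓.under (𝓞 k) := h𝔓.over
  have hb : b ∉ 𝔓 := fun hb => haw (by
    have h3 : b ^ d ∈ 𝔓 := 𝔓.pow_mem_of_mem hb d hd
    rw [hbd] at h3
    rw [hover]
    exact Ideal.mem_comap.mpr h3)
  -- hence `e - 1 ∈ 𝔓`
  have h4 : e - 1 ∈ 𝔓 := (Ideal.IsPrime.mem_or_mem ‹𝔓.IsPrime› h2).resolve_right hb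
  -- therefore `e = 1`: otherwise `1 - e` divides the order of `e`, which divides `d`, forcing `d ∈ w`
  have h5 : e = 1 := by
    by_contra hne
    have hfin : IsOfFinOrder e := isOfFinOrder_iff_pow_eq_one.mpr ⟨d, hd, hed⟩
    have hpos : 0 < orderOf e := hfin.orderOf_pos
    have hne1 : orderOf e ≠ 1 := fun h1 => hne (orderOf_eq_one_iff.mp h1)
    obtain ⟨m, hm⟩ : ∃ m : ℕ, orderOf e = m + 1 := Nat.exists_eq_succ_of_ne_zero hpos.ne'
    have hm1 : 1 ≤ m := by omega
    have hprim : IsPrimitiveRoot e (m + 1) := hm ▸ IsPrimitiveRoot.orderOf e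
    have hprod := hprim.prod_one_sub_pow_eq_order
    have hdvd : (1 - e) ∣ ((m : integralClosure (𝓞 k) Ω) + 1) := by
      rw [← hprod]
      have h0 : (0 : ℕ) ∈ Finset.range m := Finset.mem_range.mpr (by omega)
      have := Finset.dvd_prod_of_mem (fun j : ℕ => 1 - e ^ (j + 1)) h0
      simpa only [zero_add, pow_one] using this
    have h1w : 1 - e ∈ 𝔓 := by
      have := 𝔓.neg_mem h4
      rwa [neg_sub] at this
    have hm1w : ((m : integralClosure (𝓞 k) Ω) + 1) ∈ 𝔓 := by
      obtain ⟨q, hq⟩ := hdvd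
      rw [hq]
      exact 𝔓.mul_mem_right q h1w
    obtain ⟨c, hc⟩ := orderOf_dvd_of_pow_eq_one hed
    apply hdw
    rw [hover, Ideal.under, Ideal.mem_comap, map_natCast, hc, hm, Nat.cast_mul, Nat.cast_succ]
    exact 𝔓.mul_mem_right _ hm1w
  -- conclude
  have h6 : η = 1 := by
    have := congrArg Subtype.val h5
    exact this
  rw [hσα, h6, one_mul]

/-- **`Γ_k` form**: inertia groups of `\bar ℤ_k` above `w` fix the `d`-th roots in `k̄` of `w`-units of
`𝓞_k`, `w ∤ d` (no roots of unity in `k` needed). [cite: Neukirch2013, Part III Thm. (7.7) (proof, p. 176)]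
[cite: SilvermanAEC2009, Prop. VIII.1.6 (proof)] -/
theorem absoluteGaloisGroup_smul_root_eq_of_mem_inertia_of_pow_eq {d : ℕ} (hd : 0 < d)
    {a : 𝓞 k} (w : HeightOneSpectrum (𝓞 k)) (haw : a ∉ w.asIdeal)
    (hdw : ((d : ℕ) : 𝓞 k) ∉ w.asIdeal) {α : AlgebraicClosure k}
    (hα : α ^ d = algebraMap (𝓞 k) (AlgebraicClosure k) a)
    {𝔓 : Ideal (absIntegers (𝓞 k) k)} (h𝔓 : 𝔓 ∈ w.primesAbove)
    {σ : absoluteGaloisGroup k} (hσ : σ ∈ 𝔓.inertia (absoluteGaloisGroup k)) :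
    σ • α = α :=
  @smul_root_eq_of_mem_inertia_of_pow_eq k _ (AlgebraicClosure k) _ _ d hd a w haw hdw α hα 𝔓 h𝔓.1
    h𝔓.2 σ hσ

end KummerUnit

/-! ## §2. Kummer classes of local units are unramified away from `p` -/

section Unramified

variable {K : Type} [Field K] [NumberField K] {p : ℕ} [hp : Fact p.Prime]

/-- **For `a ∈ 𝓞_K` with `a ∉ w` and `p ∉ w`, `loc_w κₚ(a) ∈ H¹_ur(K_w, μₚ)`**: the Kummer cocycle
`σ ↦ σβ/β` (`βᵖ = a`) vanishes on the inertia group of `Γ_{K_w}`, which restricts into the inertia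
group `I_𝔓₀ ≤ Γ_K` of the prime `𝔓₀` of `\bar ℤ_K` cut out by `K̄ → K̄_w`
(`inertia_adicCompletionPrime_eq_map_absInertia`), and `I_𝔓₀` fixes `β` (§1).
[cite: MilneADT2006, Ch. I §2 (unramified cohomology)] [cite: Neukirch2013, Part III Thm. (7.7) (proof, p. 176)] -/
theorem localization_δ₀_mem_unramifiedSubgroup_of_not_mem (w : HeightOneSpectrum (𝓞 K)) (a : 𝓞 K)
    (haw : a ∉ w.asIdeal) (hpw : ((p : ℕ) : 𝓞 K) ∉ w.asIdeal) (ha : (a : K) ≠ 0) :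
    galoisCohomology.localization (mu K p) (Sum.inr w) 1
        ((isSES_kummer K p hp.out.pos).δ₀ (baseUnitsInvariant K (a : K) ha)) ∈
      unramifiedSubgroup (GaloisRep.toLocal w (mu K p)) 1 := by
  haveI : NeZero p := ⟨hp.out.ne_zero⟩
  set h := isSES_kummer K p hp.out.pos
  set u := baseUnitsInvariant K (a : K) ha with hu
  -- a `p`-th root `β` of `a` in `K̄ˣ`
  obtain ⟨β, hβ⟩ := h.surjective (u : UnitsCarrier K)
  have hβp : (unitsVal K β : AlgebraicClosure K) ^ p = algebraMap (𝓞 K) (AlgebraicClosure K) a := by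
    have e := congrArg (unitsVal K) hβ
    rw [kummerπ_hom_apply, unitsVal_zsmul, zpow_natCast] at e
    have e' := congrArg (fun z : (AlgebraicClosure K)ˣ => (z : AlgebraicClosure K)) e
    simp only [Units.val_pow_eq_pow_val] at e'
    rw [e', hu, coe_unitsVal_baseUnitsInvariant, IsScalarTower.algebraMap_apply (𝓞 K) K (AlgebraicClosure K)]
  rw [h.δ₀_apply_eq u β hβ]
  change galoisCohomology.res (mu K p) (w.adicCompletion K) 1 (oneCocycleClass _ _) ∈
    unramifiedSubgroup (GaloisRep.toLocal w (mu K p)) 1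
  rw [galoisCohomology.res_oneCocycleClass]
  refine (LocBridge.mem_unramifiedSubgroup_one_iff_exists (GaloisRep.toLocal w (mu K p)) _).mpr
    ⟨0, fun τ hτ => ?_⟩
  rw [galoisCohomology.pullback_absGaloisRestrict_apply, map_zero, sub_zero]
  -- `res τ` lies in the inertia group of `𝔓₀` and fixes `β`
  have hmem : absGaloisRestrict K (w.adicCompletion K) τ ∈
      (adicCompletionPrime K w).inertia (absoluteGaloisGroup K) := by
    rw [inertia_adicCompletionPrime_eq_map_absInertia]
    exact ⟨τ, hτ, rfl⟩
  have hfix : absGaloisRestrict K (w.adicCompletion K) τ • (unitsVal K β : AlgebraicClosure K) =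
      (unitsVal K β : AlgebraicClosure K) :=
    absoluteGaloisGroup_smul_root_eq_of_mem_inertia_of_pow_eq hp.out.pos w haw hpw hβp
      (adicCompletionPrime_mem_primesAbove K w) hmem
  have hfixβ : units K (absGaloisRestrict K (w.adicCompletion K) τ) β = β := by
    apply unitsVal_injective K
    rw [unitsVal_apply]
    exact Units.ext (by rw [Units.coe_smul]; exact hfix)
  apply h.injective
  rw [h.f_δ₀Cocycle_apply, map_zero]
  change units K (absGaloisRestrict K (w.adicCompletion K) τ) β - β = 0
  rw [hfixβ, sub_self]

/-- **For `a ∈ Kˣ` lying in `𝒪_wˣ · (K_wˣ)ᵖ`, `p ∉ w`: `loc_w κₚ(a) ∈ H¹_ur(K_w, μₚ)`** — by density of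
`𝓞_K` in `𝒪_w` (`closureAlgebraMapIntegers_eq_integers`) and openness of `(K_wˣ)ᵖ`, `a ≡ a'` modulo
`(K_wˣ)ᵖ` for some `a' ∈ 𝓞_K` with `a' ∉ w`, and `loc_w κₚ(a) = loc_w κₚ(a')`
(`localization_δ₀_eq_of_eq_mul_pow`).  This is the hypothesis `hKU` of `middleExact_mu_of_kummerUnramified`.
[cite: MilneADT2006, Ch. I §2 (unramified cohomology)] [cite: SilvermanAEC2009, Prop. VIII.1.6 (proof)] -/
theorem localization_δ₀_mem_unramifiedSubgroup_of_eq_unit_mul_pow (w : HeightOneSpectrum (𝓞 K)) (a : K)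
    (ha : a ≠ 0) (hpw : ((p : ℕ) : 𝓞 K) ∉ w.asIdeal)
    (hunit : ∃ (u : (w.adicCompletion K)ˣ) (c : w.adicCompletion K), Valued.v (u : w.adicCompletion K) = 1 ∧
      algebraMap K (w.adicCompletion K) a = u * c ^ p) :
    galoisCohomology.localization (mu K p) (Sum.inr w) 1
        ((isSES_kummer K p hp.out.pos).δ₀ (baseUnitsInvariant K a ha)) ∈
      unramifiedSubgroup (GaloisRep.toLocal w (mu K p)) 1 := by
  classical
  haveI : NeZero p := ⟨hp.out.ne_zero⟩
  set F := w.adicCompletion K with hF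
  haveI : CharZero F := charZero_adicCompletion w
  obtain ⟨u, c, hu1, hac⟩ := hunit
  have hc0 : c ≠ 0 := by
    rintro rfl
    rw [zero_pow hp.out.ne_zero, mul_zero] at hac
    exact (map_ne_zero_iff _ (algebraMap K F).injective).2 ha hac
  -- the open set of `x ∈ K_w` with `x ∈ u · (K_wˣ)ᵖ` and `|x| = 1`
  have hvalopen : IsOpenMap (Units.val : Fˣ → F) := by
    have hrange : Set.range (Units.val : Fˣ → F) = {0}ᶜ := by
      ext y
      simp only [Set.mem_range, Set.mem_compl_iff, Set.mem_singleton_iff]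
      exact ⟨fun ⟨z, hz⟩ => hz ▸ z.ne_zero, fun hy => ⟨Units.mk0 y hy, rfl⟩⟩
    exact (⟨Units.isEmbedding_val₀, by rw [hrange]; exact isOpen_compl_singleton⟩ :
      Topology.IsOpenEmbedding (Units.val : Fˣ → F)).isOpenMap
  set C : Set Fˣ := (fun y => u⁻¹ * y) ⁻¹' ((powMonoidHom p : Fˣ →* Fˣ).range : Set Fˣ) with hCdef
  have hCopen : IsOpen C :=
    (isOpen_range_powMonoidHom_units F (Nat.cast_ne_zero.mpr hp.out.ne_zero)).preimage (continuous_const_mul _)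
  have hsph : IsOpen {x : F | Valued.v x = 1} := by
    rw [isOpen_iff_mem_nhds]
    intro x hx
    have hx' : Valued.v x = 1 := hx
    have hx0 : x ≠ 0 := fun h => by rw [h, map_zero] at hx'; exact zero_ne_one hx'
    have hcont : ContinuousAt (fun c : F => x⁻¹ * c) x := (continuous_const_mul _).continuousAt
    have hN : {c : F | Valued.v (c - 1) < WithZero.exp (-((0 : ℕ) : ℤ))} ∈ nhds ((fun c : F => x⁻¹ * c) x) := by
      have h1 : (fun c : F => x⁻¹ * c) x = 1 := inv_mul_cancel₀ hx0
      rw [h1]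
      exact adicCompletion_setOf_valued_sub_one_lt_mem_nhds w 0
    refine Filter.mem_of_superset (hcont.preimage_mem_nhds hN) fun y hy => ?_
    have hy' : Valued.v (x⁻¹ * y - 1) < 1 := by
      have h := hy
      simp only [Set.mem_preimage, Set.mem_setOf_eq, Nat.cast_zero, neg_zero, WithZero.exp_zero] at h
      exact h
    have h2 : Valued.v (x⁻¹ * y) = 1 := by
      have h3 : Valued.v (x⁻¹ * y - 1) < Valued.v (1 : F) := by rw [map_one]; exact hy'
      rw [Valuation.map_eq_of_sub_lt Valued.v h3, map_one]
    change Valued.v y = 1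
    rw [map_mul, map_inv₀, hx', inv_one, one_mul] at h2
    exact h2
  set O : Set F := Units.val '' C ∩ {x : F | Valued.v x = 1} with hOdef
  have hOopen : IsOpen O := (hvalopen _ hCopen).inter hsph
  have huO : (u : F) ∈ O := by
    refine ⟨⟨u, ?_, rfl⟩, hu1⟩
    change u⁻¹ * u ∈ (((powMonoidHom p : Fˣ →* Fˣ).range : Subgroup Fˣ) : Set Fˣ)
    rw [inv_mul_cancel]; exact Subgroup.one_mem _
  -- `u ∈ 𝒪_w = closure of 𝓞_K`
  have huint : (u : F) ∈ closure ((algebraMap (𝓞 K) F).range : Set F) := by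
    have h := IsDedekindDomain.HeightOneSpectrum.closureAlgebraMapIntegers_eq_integers (A := 𝓞 K) K w
    have h' : (u : F) ∈ (SetLike.coe (w.adicCompletionIntegers K) : Set (w.adicCompletion K)) :=
      (HeightOneSpectrum.mem_adicCompletionIntegers (𝓞 K) K w).mpr hu1.le
    rw [← h] at h'
    exact h'
  obtain ⟨z, ⟨hzC, hz1⟩, ⟨a', rfl⟩⟩ := mem_closure_iff.mp huint O hOopen huO
  obtain ⟨y, hyC, hy⟩ := hzC
  obtain ⟨s, hs⟩ := hyC
  -- `a' ∈ 𝓞_K` is a `w`-unit, nonzero, congruent to `a` modulo `p`-th powers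
  have hz1' : Valued.v (algebraMap (𝓞 K) F a') = 1 := hz1
  have haw : a' ∉ w.asIdeal := by
    have h1 : Valued.v (((a' : K)) : w.adicCompletion K) = 1 := by
      rw [← algebraMap_adicCompletion_apply, ← IsScalarTower.algebraMap_apply]; exact hz1'
    rw [IsDedekindDomain.HeightOneSpectrum.valuedAdicCompletion_eq_valuation',
      show ((a' : K)) = algebraMap (𝓞 K) K a' from rfl,
      IsDedekindDomain.HeightOneSpectrum.valuation_of_algebraMap,
      IsDedekindDomain.HeightOneSpectrum.intValuation_eq_one_iff] at h1
    exact h1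
  have ha'0 : ((a' : K)) ≠ 0 := fun h0 => by
    have : algebraMap (𝓞 K) F a' = 0 := by
      rw [IsScalarTower.algebraMap_apply (𝓞 K) K F, show algebraMap (𝓞 K) K a' = (a' : K) from rfl, h0,
        map_zero]
    rw [this, map_zero] at hz1'
    exact zero_ne_one hz1'
  have hy1 : y = u * s ^ p := by rw [← powMonoidHom_apply, hs, mul_inv_cancel_left]
  have hrel : algebraMap K F a = algebraMap K F (a' : K) * ((c : F) * ((s : Fˣ) : F)⁻¹) ^ p := by
    have hya' : algebraMap K F (a' : K) = (y : F) := by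
      rw [hy, IsScalarTower.algebraMap_apply (𝓞 K) K F]
    rw [hya', hy1, hac, Units.val_mul, Units.val_pow_eq_pow_val, mul_pow, inv_pow]
    field_simp
  have hc' : (c : F) * ((s : Fˣ) : F)⁻¹ ≠ 0 := mul_ne_zero hc0 (inv_ne_zero s.ne_zero)
  rw [localization_δ₀_eq_of_eq_mul_pow w (a' : K) a ha'0 ha hc' hrel]
  exact localization_δ₀_mem_unramifiedSubgroup_of_not_mem w a' haw hpw ha'0

end Unramified

/-! ## §3. Milne I Thm. 4.10(b) `Ker γ¹ ⊆ Im β¹` for `μₚ` over a totally complex number field -/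

section MiddleExact

variable {K : Type} [Field K] [NumberField K] {p : ℕ} [hp : Fact p.Prime]

/-- **Milne *ADT* I Thm. 4.10(b), inclusion `Ker γ¹ ⊆ Im β¹`, for `M = μₚ` over a totally complex
number field, for THE invariant maps** — the hypothesis `hE` of
`exists_localInvariants_duality_of_middleExact_canonical` (p484492) in the instance `ρ = mu K p`: for a
finite set `S` of places containing the infinite ones with `p ∉ w` off `S`, every family of local classes
`t_v ∈ H¹(K_v, μₚ)` orthogonal (sum over `S` of the local Tate pairings of `LocalInvariants.canonical K p`)
to all classes of `H¹(K, μₚ^D)` unramified outside `S` is the localisation on `S` of a global class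
unramified outside `S`.  UNCONDITIONAL: `middleExact_mu_of_kummerUnramified` with `hKU` discharged by
`localization_δ₀_mem_unramifiedSubgroup_of_eq_unit_mul_pow`.  (First module for which the middle exactness
of the Poitou–Tate sequence is a tree theorem; the general `hE` — all finite `M` — is NOT claimed.)
[cite: MilneADT2006, Ch. I, Thm. 4.10(b)] [cite: CasselsFrohlichANT1967, Ch. VII §5.1 Main Theorem (B), (D), §11] -/
theorem middleExact_mu (hK : ∀ w : InfinitePlace K, w.IsComplex)
    (S : Finset (Place K)) (hinf : ∀ w : InfinitePlace K, (Sum.inl w : Place K) ∈ S)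
    (hS : ∀ v : HeightOneSpectrum (𝓞 K), (Sum.inr v : Place K) ∉ S →
      ((p : ℕ) : 𝓞 K) ∉ v.asIdeal ∧ GaloisRep.IsUnramifiedAt v (mu K p))
    (t : Π v : Place K, galoisCohomology ((mu K p).toLocal v) 1)
    (horth : ∀ y : galoisCohomology ((mu K p).tateDual p) 1,
      (∀ v : HeightOneSpectrum (𝓞 K), (Sum.inr v : Place K) ∉ S →
        galoisCohomology.localization ((mu K p).tateDual p) (Sum.inr v) 1 y ∈
          unramifiedSubgroup (GaloisRep.toLocal v ((mu K p).tateDual p)) 1) →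
      ∑ v ∈ S, localTatePairingZMod (mu K p) p v (LocalInvariants.canonical K p v) (t v)
        (galoisCohomology.localization ((mu K p).tateDual p) v 1 y) = 0) :
    ∃ x : galoisCohomology (mu K p) 1,
      (∀ v : HeightOneSpectrum (𝓞 K), (Sum.inr v : Place K) ∉ S →
        galoisCohomology.localization (mu K p) (Sum.inr v) 1 x ∈
          unramifiedSubgroup (GaloisRep.toLocal v (mu K p)) 1) ∧
      ∀ v ∈ S, galoisCohomology.localization (mu K p) v 1 x = t v :=
  middleExact_mu_of_kummerUnramified hK
    (fun w a ha hpw hunit => localization_δ₀_mem_unramifiedSubgroup_of_eq_unit_mul_pow w a ha hpw hunit)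
    S hinf hS t horth

end MiddleExact



end Summit.BirchSwinnertonDyer.BirchSwinnertonDyer.Theorems.SchneiderFreeAdditiveX3.PoitouTateReduction

end
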